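import Summits.QuantumFields.YangMills.Theorems.AllWindowsColdBoxTiltMomentsOfCubic
import Summits.QuantumFields.YangMills.Theorems.AllWindowsColdBoxTiltCubicVariance
import Summits.QuantumFields.YangMills.Theorems.AllWindowsColdBoxGaussPolyHypercontractivity
import Summits.QuantumFields.YangMills.Theorems.AllWindowsColdBoxDirFreeVarLinear
import Summits.QuantumFields.YangMills.Theorems.AllWindowsColdBoxDirPoincareCubic
import HarnessLib

/-!
# LINE-17 «hypercontractive second-order tilt expansion» on crux `AllWindowsColdBox.BoxMidWindowsSU22` (stmt-QuantumFields-24003):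
# registered stub E `stub_tiltMoments`, BY NAME AND SIGNATURE

`stub_tiltMoments : GaussPolyHypercontractivity → DirFreeVarLinear → DirPoincareCubic → ∀ θ, 0 < θ → θ ≤ 1/16 → TiltMoments θ`
(STUB-PLAN-E-24003 of planner ym-idea-2): both clauses are `tiltMoments_of_cubic` (`…TiltMomentsOfCubic`: E(4) dominators, E(7) capped
exponential moment, E(8) assembly, thresholds) fed with the cubic-chaos moment package `ColdBoxAllGroups.tiltCubicW_moment_package ρ₂`
(`…TiltCubicVariance`, seat w5: E(0) Taylor, E(1) chaos form, E(3) Gram bound, E(2)∘E(5) hypercontractivity; integrability conjunct from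
`…TiltCubicIntegrable`).  The three named inputs B (`GaussPolyHypercontractivity`), C (`DirFreeVarLinear`), D (`DirPoincareCubic`) of the
registered signature are not used beyond the tree theorems already invoked inside those files (B's content via `pi_multivariateGaussian_bonami`,
C's via the coordinate Gaussian moments; D not at all), so they are taken anonymously.

No definition; standard axioms.  HONEST LABEL: ONE registered stub (E) of one critic-PASSed line on the R2ξ″ RECORD-rung crux 24003; the
line stays open at stub F `stub_gaussSideTerms`; no crux, rung or summit is proved; the Yang–Mills mass gap is NOT proved by this file.
-/

set_option autoImplicit false

noncomputable section

open Summit.QuantumFields.YangMills.Theorems.ColdBoxAllGroups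
open Summit.QuantumFields.YangMills.Theorems.FreeEnergyLogCoefficient
open Summit.QuantumFields.YangMills.Theorems.AllWindowsColdBox.GaussHypercontractivity (GaussPolyHypercontractivity)
open Summit.QuantumFields.YangMills.Theorems.AllWindowsColdBoxDirFreeVar (DirFreeVarLinear)
open Summit.QuantumFields.YangMills.Theorems.AllWindowsColdBox.DirPoincare (DirPoincareCubic)

namespace Summit.QuantumFields.YangMills.Theorems.AllWindowsColdBoxBoxMidLine

/-- **STUB E of LINE-17 (crux stmt-QuantumFields-24003), by name and registered signature**: for `0 < θ ≤ 1/16`, `TiltMoments θ` —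
for every admissible single-link density, eventually in `β`, `‖log ℓ − E_ν log ℓ‖_{L⁸(ν)} ≤ K·⌈β^θ⌉⁶/β` and `E_ν e^{4|log ℓ − E_ν log ℓ|} ≤ 4`
under the conditioned Dirichlet Gaussian `ν = lineGauss θ β`.  Proof: `tiltMoments_of_cubic` + `tiltCubicW_moment_package ρ₂`
(whose `0 < β` version is specialised to `1 ≤ β`). -/
theorem stub_tiltMoments : GaussPolyHypercontractivity → DirFreeVarLinear → DirPoincareCubic → ∀ θ : ℝ, 0 < θ → θ ≤ 1 / 16 → TiltMoments θ := by
  intro _ _ _ θ hθ hθ16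
  obtain ⟨K₁, hK₁, h⟩ := tiltCubicW_moment_package ρ₂
  exact tiltMoments_of_cubic ⟨K₁, hK₁, fun H β hH hβ => h H β hH (lt_of_lt_of_le one_pos hβ)⟩ θ hθ hθ16

end Summit.QuantumFields.YangMills.Theorems.AllWindowsColdBoxBoxMidLine

end
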